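import Summits.Ventures.HSemireg.WedgeHankelRecurrenceGaussHoffmanWielandtBounds

/-!
# Venture HSemireg — **ALGEBRAIC COROLLARIES OF SCHUR'S THEOREM: COPRIMALITY AND SEPARABILITY** — over ANY field, consecutive recurrence polynomials `q_{n+1}, q_n` are COPRIME as soon as
# `b_1 ⋯ b_n ≠ 0` (`Res = ∏(−b_k)^k ≠ 0`, N403); and the discriminant formulas of N405 ∕ N407 ∕ N408 give SEPARABILITY (simple zeros in any extension) with no reality ∕ positivity
# hypothesis: **`He_n` and `T_{n+1}, U_{n+1}` are separable over every field of characteristic `0`**, and **`L_{n+1}^{(α)}` is separable for every real `α ∉ {−1, …, −(n+1)}`** (e.g. `α = −3∕2`,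
# outside the orthogonality range `α > −1`)

HONEST FRAMING. Part of the Lean index of the computation cell `pub-hsemireg` (seat p10 gen 47, Sunday typer «UNIFORM-IN-n»).  Polynomial algebra over fields only (Mathlib `Polynomial.resultant ∕
discr ∕ Separable ∕ IsCoprime`); no variety, no cohomology theory, no sheaf, no Ext group and no semiregularity map is constructed here; nothing here says that HC / HC_CM / HC_AV holds; no Literature
fact (unproved `Prop`) is declared or used.  Custodian versions as in `WedgeHankelSiegelIdeal` (1/3).
SOURCES (cited).  I. Schur, J. reine angew. Math. 165 (1931) 52–58, §1 (`Res ≠ 0 ⇒` no common zero); G. Szegő, *Orthogonal Polynomials*, Thm 3.3.1 ∕ §6.71 (simplicity of the zeros; here obtained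
algebraically from `disc ≠ 0`), §6.73 (Laguerre and Jacobi polynomials for general parameters: `L_n^{(α)}` has only simple zeros unless `α ∈ {−1, …, −n}`, cf. (6.73.2));  S. Basu, R. Pollack,
M.-F. Roy, *Algorithms in Real Algebraic Geometry*, Prop. 4.15 ∕ 4.16 (`Res ≠ 0 ⟺` coprime; `disc ≠ 0 ⟺` separable) — the lineage's N94 ∕ N151-block lemmas.
PROOF TYPED HERE.  N94 `resultant_ne_zero_iff_isCoprime_of_monic` + N403 `schur_resultant`; N151-block `separable_iff_discr_ne_zero_of_natDegree_eq` + N405 `hermite_discr` ∕ N405 `discr_map_of_injective`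
∕ N407 `chebyshevT_discr`, `chebyshevU_discr` ∕ N408 `laguerre_discr`; characteristic `0` makes the integer values nonzero.
DEDUP DISCLOSURE (`rg -n -i 'separable|isCoprime' Summits/Ventures/HSemireg/WedgeHankelRecurrenceGauss*`, 2026-09-04): N276 `recurrence_no_common_root` (real, `b > 0`, via Christoffel–Darboux);
nothing on `Separable` for the classical families; 0 hits for the 6 names below.

WHAT IS IN THE TREE.  N94 `resultant_ne_zero_iff_isCoprime_of_monic`; N151-block `separable_iff_discr_ne_zero_of_natDegree_eq`; N403, N404, N405, N407, N408 as cited.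
THIS FILE (namespace `Summit.Ventures.HSemireg.Wedge.HankelOuter` continued; CHAINED on N418 (import only); 0 definitions):
* §1184 **`recurrence_isCoprime`** (any field, `b_k ≠ 0`), `recurrence_separable_of_pos` (real, `b > 0`), **`hermite_separable`** (char `0`), **`chebyshevT_separable`**, **`chebyshevU_separable`**
  (char `0`), **`laguerre_separable`** (`(α+1)⋯(α+n+1) ≠ 0`).
CAVEATS.  Characteristic `0` is used only to make `∏ k^k`, `(n+1)^{n+1} 2^{n²}`, `(n+2)^{n+1} 2^{(n+1)²}` nonzero; in characteristic `p` the same formulas decide separability case by case (not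
typed).  Nothing Ext-side.  New names only.
-/

open Module Polynomial
open scoped Matrix Polynomial

namespace Summit.Ventures.HSemireg.Wedge.HankelOuter

/-! ## §1184. Coprimality and separability from the resultant ∕ discriminant formulas -/

/-- **SCHUR: over any field, `b_1, …, b_n ≠ 0 ⇒ q_{n+1}` and `q_n` are coprime.** [Schur 1931 §1; BPR Prop 4.15; this file, §1184] -/
theorem recurrence_isCoprime {K : Type*} [Field K] {q : ℕ → K[X]} {a b : ℕ → K} (hq0 : q 0 = 1) (hq1 : q 1 = Polynomial.X - C (a 0))
    (hrec : ∀ n, q (n + 2) = (Polynomial.X - C (a (n + 1))) * q (n + 1) - C (b (n + 1)) * q n) {n : ℕ} (hb : ∀ k, k < n → b (k + 1) ≠ 0) : IsCoprime (q (n + 1)) (q n) := by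
  classical
  obtain ⟨hd1, hl1⟩ := recurrence_natDegree_leadingCoeff hq0 hq1 hrec (n + 1)
  obtain ⟨hdn, -⟩ := recurrence_natDegree_leadingCoeff hq0 hq1 hrec n
  have hm : (q (n + 1)).Monic := by rw [Monic, hl1]
  refine (resultant_ne_zero_iff_isCoprime_of_monic K hm (by rw [hd1]; omega) (q n)).1 ?_
  show (q (n + 1)).resultant (q n) (q (n + 1)).natDegree (q n).natDegree ≠ 0
  rw [hd1, hdn, schur_resultant hq0 hq1 hrec n]
  exact Finset.prod_ne_zero_iff.2 fun k hk => pow_ne_zero _ (neg_ne_zero.2 (hb k (Finset.mem_range.1 hk)))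

/-- **A positive real recurrence has separable members** (`disc q_{t+1} > 0`, N410). [Szegő Thm 3.3.1; this file, §1184] -/
theorem recurrence_separable_of_pos {q : ℕ → ℝ[X]} {a b : ℕ → ℝ} (hq0 : q 0 = 1) (hq1 : q 1 = Polynomial.X - C (a 0))
    (hrec : ∀ n, q (n + 2) = (Polynomial.X - C (a (n + 1))) * q (n + 1) - C (b (n + 1)) * q n) (hb : ∀ j, 0 < b j) (t : ℕ) : (q (t + 1)).Separable := by
  classical
  exact (separable_iff_discr_ne_zero_of_natDegree_eq ℝ (recurrence_natDegree_leadingCoeff hq0 hq1 hrec (t + 1)).1).2 (recurrence_discr_pos hq0 hq1 hrec hb t).ne'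

/-- **`He_n` is separable over every field of characteristic `0`** (`disc He_n = ∏ k^k ≠ 0`). [Hilbert 1888 + BPR Prop 4.16; this file, §1184] -/
theorem hermite_separable (K : Type*) [Field K] [CharZero K] (n : ℕ) : ((Polynomial.hermite n).map (Int.castRingHom K)).Separable := by
  classical
  rcases n with _ | n
  · rw [Polynomial.hermite_zero, Polynomial.map_C, map_one, C_1]; exact Polynomial.separable_one
  have hd : ((Polynomial.hermite (n + 1)).map (Int.castRingHom K)).natDegree = n + 1 := by
    rw [natDegree_map_eq_of_injective (Int.castRingHom K).injective_int, Polynomial.natDegree_hermite]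
  refine (separable_iff_discr_ne_zero_of_natDegree_eq K hd).2 ?_
  rw [discr_map_of_injective (Int.castRingHom K).injective_int, hermite_discr, map_prod]
  exact Finset.prod_ne_zero_iff.2 fun k _ => by rw [map_pow]; exact pow_ne_zero _ (by rw [eq_intCast]; push_cast; exact Nat.cast_add_one_ne_zero k)

/-- **`T_{n+1}` is separable over every field of characteristic `0`** (`disc = (n+1)^{n+1} 2^{n²}`). [Stieltjes–Hilbert + BPR Prop 4.16; this file, §1184] -/
theorem chebyshevT_separable (K : Type*) [Field K] [CharZero K] (n : ℕ) : (Polynomial.Chebyshev.T K ((n : ℤ) + 1)).Separable := by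
  classical
  have hd : (Polynomial.Chebyshev.T K ((n : ℤ) + 1)).natDegree = n + 1 := by
    have : NeZero (2 : K) := ⟨two_ne_zero⟩
    rw [Polynomial.Chebyshev.natDegree_T]; omega
  refine (separable_iff_discr_ne_zero_of_natDegree_eq K hd).2 ?_
  rw [← Polynomial.Chebyshev.map_T (Int.castRingHom K), discr_map_of_injective (Int.castRingHom K).injective_int, chebyshevT_discr, map_mul, map_pow, map_pow, eq_intCast, eq_intCast]
  push_cast
  exact mul_ne_zero (pow_ne_zero _ (Nat.cast_add_one_ne_zero n)) (pow_ne_zero _ two_ne_zero)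

/-- **`U_{n+1}` is separable over every field of characteristic `0`** (`(n+2)² disc = (n+2)^{n+1} 2^{(n+1)²}`). [Stieltjes–Hilbert + BPR Prop 4.16; this file, §1184] -/
theorem chebyshevU_separable (K : Type*) [Field K] [CharZero K] (n : ℕ) : (Polynomial.Chebyshev.U K ((n : ℤ) + 1)).Separable := by
  classical
  have hd : (Polynomial.Chebyshev.U K ((n : ℤ) + 1)).natDegree = n + 1 := by
    have : NeZero (2 : K) := ⟨two_ne_zero⟩
    have h := Polynomial.Chebyshev.natDegree_U_natCast K (n + 1)
    push_cast at h
    exact h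
  refine (separable_iff_discr_ne_zero_of_natDegree_eq K hd).2 ?_
  have h := chebyshevU_discr n
  intro h0
  rw [← Polynomial.Chebyshev.map_U (Int.castRingHom K), discr_map_of_injective (Int.castRingHom K).injective_int] at h0
  have h2 := congrArg (Int.castRingHom K) h
  rw [map_mul, h0, mul_zero, map_mul, map_pow, map_pow, eq_intCast, eq_intCast] at h2
  push_cast at h2
  have hn2 : (n : K) + 2 ≠ 0 := by
    have h3 : ((n + 2 : ℕ) : K) ≠ 0 := Nat.cast_ne_zero.2 (by omega)
    push_cast at h3
    exact h3
  exact absurd h2.symm (mul_ne_zero (pow_ne_zero _ hn2) (pow_ne_zero _ two_ne_zero))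

/-- **LAGUERRE FOR GENERAL REAL `α`: if `(α+1)(α+2)⋯(α+n+1) ≠ 0` then `L_{n+1}^{(α)}` is separable** (simple zeros, possibly non-real ∕ non-positive when `α < −1`). [Szegő §6.73;
Stieltjes–Hilbert (6.71.6); this file, §1184] -/
theorem laguerre_separable {L : ℕ → ℝ[X]} {a b : ℕ → ℝ} {α : ℝ} (hL0 : L 0 = 1) (hL1 : L 1 = Polynomial.X - C (a 0))
    (hLrec : ∀ n, L (n + 2) = (Polynomial.X - C (a (n + 1))) * L (n + 1) - C (b (n + 1)) * L n) (ha : ∀ n, a n = 2 * n + 1 + α)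
    (hb : ∀ n, b (n + 1) = ((n : ℝ) + 1) * ((n : ℝ) + 1 + α)) {n : ℕ} (hne : ∏ k ∈ Finset.range (n + 1), ((k : ℝ) + 1 + α) ≠ 0) : (L (n + 1)).Separable := by
  classical
  refine (separable_iff_discr_ne_zero_of_natDegree_eq ℝ (recurrence_natDegree_leadingCoeff hL0 hL1 hLrec (n + 1)).1).2 ?_
  rw [laguerre_discr hL0 hL1 hLrec ha hb hne]
  have hk : ∀ k ∈ Finset.range (n + 1), (k : ℝ) + 1 + α ≠ 0 := fun k hk => (Finset.prod_ne_zero_iff.1 hne) k hk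
  exact Finset.prod_ne_zero_iff.2 fun k hk' => mul_ne_zero (pow_ne_zero _ (by positivity)) (pow_ne_zero _ (hk k hk'))

end Summit.Ventures.HSemireg.Wedge.HankelOuter
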